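import Summits.QuantumFields.YangMills.Theorems.DirichletWindowLocalGaussianityExpMomentTangentLaw
import HarnessLib

/-!
# LINE-3 (seat ym-idea-4, gen 4) — DW's TARGET `LocalGaussianity` (item stmt-QuantumFields-12314 = 8938 ∧ 8939) from THREE stubs:
# «exp-moment tangent law» = chessboard exponential moments ⊕ the LANDED general tangent law (T0) of `EquipartitionPinsProbe`

Observation (made while answering idea-crit-4's CHECK on LINE-1): the landed `EquipartitionPinsProbe.stub_tangent` states (T0) for the JOINT
laws of the scaled raw plaquette costs `X_p = β(N − Re tr r(U_p))` over ANY finite family of plaquettes (any planes) against bounded continuous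
test functions, and `stub_rigidity` identifies every tangent law as `curvatureGaussianField 4 D` (`X_p ↦ ½|Y_p|²`).  The only thing separating
(T0) from the SECOND-ORDER quantities of `DirichletWindow` — `β² f_β(n e₀) = Cov_μ(X_0, X_{n e₀})` and `β² f_β(0) = Var_μ X_0` — is UNIFORM
INTEGRABILITY of `X_0 X_n`, and the chessboard exponential moment `E_μ e^{X_p/2} ≤ C` (LINE-2's engine: FILS even / `SoloBlind` odd /
`FreeEnergyLogCoefficient_holds` 8759 / thermodynamic limit / limit states) supplies all moments.  Hence, uniformly over torus-limit states,
`β² f_β(n e₀) → (D/2)·c_n²` (Isserlis: `Cov(½|Y_0|², ½|Y_n|²) = ¼·D·2c_n²`, `c_n = curvatureTwoPoint((0;0,1),(n e₀;0,1)) = kernel01 n`), which gives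
`FixedDistanceLower` (8938) with the SHARP constant via `KernelLower` (`|c_n| ≥ κ'/n⁴`, shared with LINE-1 / p597157) and `PlaquetteVarianceUpper`
(8939) at `n = 0`.  Three stubs; the LANDED composition `LocalGaussianityExpMomentTangentLaw.localGaussianity_of` (p599554, commit bba69f9e) gives the closed skeleton theorem
`LocalGaussianity_skeleton`, which concludes `DirichletWindow.LocalGaussianity` (the route's TARGET node) BY NAME,
hence (landed door) `XiDiverges` (8941).  Supersedes LINE-1 (no RP cones / probe ratio needed) and subsumes LINE-2.  No rung / summit statement is
proved by this line.

References: Fröhlich–Israel–Lieb–Simon, CMP 62 (1978) Thm 4.3 [FILS1978]; Osterwalder–Seiler, Ann. Phys. 110 (1978) [OsterwalderSeiler1978];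
S. Chatterjee, arXiv:1602.01222 §§11–14 (local free-gluon law), arXiv:1803.01950 Problem 5.1; Lawler–Limic 2010 §4.3 (lattice Green asymptotics).
-/

/-! ## Shape (v2, 2026-08-28T03:3xZ — fixes `skeleton.extra-hypothesis` of v1): the two obligation statements `ExpMomentBound`,
`SecondOrderLocalLaw` and the composition `localGaussianity_of` now live in the LANDED module
`Theorems/DirichletWindowLocalGaussianityExpMomentTangentLaw.lean` (namespace `…Theorems.LocalGaussianityExpMomentTangentLaw`);
`KernelLower` (+ `axis`, `kernel01`) in the LANDED `Theorems/DirichletWindowFixedDistanceLowerPsdTransfer.lean` (p597157).  This file declares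
ONLY the three registered stubs and the CLOSED skeleton theorem (no hypotheses), as the A12 skeleton audit requires.
STUB-PLAN for the hardest stub: `pub/ideators/ym-idea-4/LINES-g4.md` § STUB-PLAN. -/

set_option autoImplicit false

open Summit.QuantumFields.YangMills.Theorems.FixedDistanceLowerPsdTransfer (KernelLower)
open Summit.QuantumFields.YangMills.Theorems.LocalGaussianityExpMomentTangentLaw (ExpMomentBound SecondOrderLocalLaw localGaussianity_of)

namespace Summit.QuantumFields.YangMills.Cruxes.LocalGaussianity.ExpMomentTangentLaw

/-- STUB 1 (M, wiring of tree theorems) — chessboard exponential moment `E_μ e^{X_p/2} ≤ C` in every torus-limit state at weak coupling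
(FILS even tori `WilsonPlaquetteTail.integral_plaquette_le_rpow_sites` with `f = e^{(β/2)φ}` / odd tori `SoloBlind.wilsonExpectation_exp_plaquetteCost_le`
/ constant term `FreeEnergyLogCoefficient_holds` (8759) + `exists_hasFreeEnergyDensity_holds` / limit passage for a bounded continuous cylinder observable). -/
theorem stub_expMomentBound : ExpMomentBound := by
  sorry

/-- STUB 2 (M–L, the hardest) — second-order local free-gluon law `β² f_β(n e₀) → D_h c_n²` uniformly over limit states, from STUB 1 (uniform
integrability) + `EquipartitionPinsProbe.stub_tangent` (T0) + `stub_rigidity` (τ = curvatureGaussianField 4 D) + Isserlis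
(`covariance_eval_curvatureGaussianField`, `isGaussianProcess_eval_curvatureGaussianField`); contradiction wrapper delivers `∀ μ ∈ LP_β` uniformly. -/
theorem stub_secondOrderLocalLaw : ExpMomentBound → SecondOrderLocalLaw := by
  sorry

/-- STUB 3 (M) — `|c_n| ≥ κ'/n⁴` eventually for the in-plane axial lattice-Maxwell plaquette kernel `c_n = kernel01 n` (second lattice differences of
the 4-D Green function: `c_n = (Δ₂+Δ₃)G(n e₀)`, numerics `n⁴ c_n → −1/π²`, sign-stable; axial Fourier/Laplace representation or Lawler–Limic 4.3.1 +
Uchiyama's expansion). Shared with LINE-1 (input 4 of p597157). -/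
theorem stub_kernelLower : KernelLower := by
  sorry

/-- SKELETON THEOREM (closed; kernel-checked modulo the three stubs): DW's target `LocalGaussianity` BY NAME. -/
theorem LocalGaussianity_skeleton : Summit.QuantumFields.YangMills.Theses.DirichletWindow.LocalGaussianity :=
  localGaussianity_of stub_expMomentBound stub_secondOrderLocalLaw stub_kernelLower

end Summit.QuantumFields.YangMills.Cruxes.LocalGaussianity.ExpMomentTangentLaw
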